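import Summits.CriticalPhenomena.PercolationContinuityZ3.Theorems.Transplant.PlanarSkeletonConcDefs
import Summits.CriticalPhenomena.PercolationContinuityZ3.Theorems.Transplant.HeisenbergCylinderConnected
import Summits.CriticalPhenomena.PercolationContinuityZ3.Theorems.PercNearOneGluingNoHeavySamePHeisenbergPrismEscape
import HarnessLib

/-!
# The Heisenberg group `H₃(ℤ)` carries the design-(D) interface `PlanarSkeletonConc` (degree `4`, outward steps, connected cylinders
# `{|x|, |y| ≤ ℓ}` for `ℓ ≥ 1`); `θ_{H₃(ℤ)}(p_c) = 0` from the (D)-form node of record `SamePDropOfSkeletonConcLt`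

builds on p205010 (kernel theorem, internal audit signed; external expert review pending) — nothing in this file uses p205010.
Status sentence (coordinator 2026-08-20T04:30Z): "θ(p_c) = 0 on ℤ^d, all d ≥ 2 — kernel-verified (Lean 4/Mathlib, standard axioms);
internal adversarial audit SIGNED 2026-08-20 04:29Z; external expert review pending."

Lane `prim-bschramm`, seat `prim-bschramm-p4` (gen 5; class map, memo `P4-GENERAL.md` §13), helper file
(`--supports stmt-CriticalPhenomena-4575`).  First INSTANCE of the interface `PlanarSkeletonConc` (stmt-g6, `PlanarSkeletonConcDefs.lean` p229853,
design of record SHEAR-SCOPE §p3 / V83; lead g3 18:03:28Z: the instance files are p4's, the obligations are imported).  Per SHEAR-SCOPE §3.7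
the Heisenberg instance owes exactly: (μ) degree `≤ 4` (tree: `SameP.heis_degree_le`), (ι) outward steps (the right generators `a^{±1}`,
`b^{±1}` move the abelianisation `heisAb = (x, y)` by `±e₀`, `±e₁` at EVERY vertex — `heis_step`, from the tree's `heis_adj_mulA/B/Ainv/Binv`),
(κ) connectivity of the induced cylinder graphs `G[heisCyl ℓ]`, `ℓ ≥ 1` (tree: p3-g4's `heisCylGraph_connected`, p230096 — the commutator
4-cycle at the identity column; `ℓ = 0` is an edgeless column, so `ℓ ≥ 1` is sharp).

* `heisSkeletonConc : PlanarSkeletonConc cayleyGraph` — extends `heisSkeleton` (p209990: `φ = heisAb`, base vertex `1`, frames = left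
  translations, point group `D₄`);
* `heisenbergCriticalContinuity_of_skeletonConcNode : SamePDropOfSkeletonConcLt → HeisenbergCriticalContinuity` — `θ_{H₃(ℤ)}(p_c) = 0`
  CONDITIONAL on the node of record alone (the (D)-form drop node at `p < 1`, lead g3 17:54:17Z; uniqueness by the tree's Burton–Keane on
  the amenable Cayley graph, cylinders subcritical at `p_c < 1` by bounded cutsets p208219, `p_c(H₃) < 1` p208686); `…_of_conc` from the
  binder-less `SamePDropOfSkeletonConc`.  Nothing is claimed about either node.
[cite: CheegerKleinerNaor2011, §1.1] [cite: BenjaminiSchramm1996, Conj. 4] [cite: KozmaNitzan2024, §4 p. 15 (boxes); §1 p. 2 (approach 1)]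
-/

noncomputable section

namespace Summit.CriticalPhenomena.PercolationContinuityZ3.Theorems.Transplant

open MeasureTheory Literature.Probability.Percolation Literature.Probability.LatticeModels SimpleGraph
open Literature.Geometry.MetricEmbeddings (cayleyGraph cayleyGraph_connected)
open Literature.Barriers.CriticalPhenomena (IsQuasiTransitive IsGraphAmenable)
open SameP (heisAb heisCyl heisCylGraph heis_degree_le)

/-- **(ι) outward steps for `H₃(ℤ)`**: at every vertex the right generators `a^{±1}`, `b^{±1}` move the abelianisation by `±e₀`, `±e₁`.
[cite: CheegerKleinerNaor2011, §1.1] -/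
theorem heis_step (v : ℤ × ℤ × ℤ) (i : Fin 2) (σ : ℤˣ) :
    ∃ v' : ℤ × ℤ × ℤ, cayleyGraph.Adj v v' ∧ heisAb v' = heisAb v + Pi.single i (σ : ℤ) := by
  obtain ⟨x, y, z⟩ := v
  rcases Int.units_eq_one_or σ with rfl | rfl <;> fin_cases i
  · refine ⟨(x + 1, y, z), heis_adj_mulA x y z, ?_⟩
    ext j; fin_cases j <;> simp [heisAb]
  · refine ⟨(x, y + 1, z + x), heis_adj_mulB x y z, ?_⟩
    ext j; fin_cases j <;> simp [heisAb]
  · refine ⟨(x - 1, y, z), heis_adj_mulAinv x y z, ?_⟩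
    ext j; fin_cases j <;> simp [heisAb, sub_eq_add_neg]
  · refine ⟨(x, y - 1, z - x), heis_adj_mulBinv x y z, ?_⟩
    ext j; fin_cases j <;> simp [heisAb, sub_eq_add_neg]

/-- **`H₃(ℤ)` carries the design-(D) interface**: `heisSkeleton` + degree `4` + outward steps + connected cylinders (`ℓ ≥ 1`).
[cite: KozmaNitzan2024, §4 p. 15] [cite: CheegerKleinerNaor2011, §1.1] -/
def heisSkeletonConc : PlanarSkeletonConc cayleyGraph where
  toPlanarSkeleton := heisSkeleton
  Δ := 4
  degree_le := heis_degree_le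
  step := heis_step
  cyl_connected := by
    intro t ht ℓ hℓ
    have ht' : t = (0, 0, 0) := by simpa [heisSkeleton] using ht
    subst ht'
    have e : {w : ℤ × ℤ × ℤ | heisSkeleton.φ w - heisSkeleton.φ (0, 0, 0) ∈ box 2 ℓ} = heisCyl ℓ := heisSkeleton_cyl ℓ
    rw [e]
    exact heisCylGraph_connected hℓ

/-- The underlying planar skeleton is `heisSkeleton`. [folklore] -/
@[simp] theorem heisSkeletonConc_toPlanarSkeleton : heisSkeletonConc.toPlanarSkeleton = heisSkeleton := rfl

/-- **`θ_{H₃(ℤ)}(p_c) = 0` from the node of record `SamePDropOfSkeletonConcLt`** (the (D)-form drop node at densities `p < 1`; NOT proved,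
never asserted): connected, quasi-transitive, amenable Cayley graph (uniqueness by the tree's Burton–Keane), `p_c(H₃) < 1`, interface
`heisSkeletonConc`, cylinders subcritical at `p_c`.  Conditional on the node alone. [cite: BenjaminiSchramm1996, Conj. 4] [cite: KozmaNitzan2024, §1 p. 2 (approach 1)] -/
theorem heisenbergCriticalContinuity_of_skeletonConcNode (hD : SamePDropOfSkeletonConcLt) : HeisenbergCriticalContinuity := by
  unfold HeisenbergCriticalContinuity
  refine continuity_of_skeletonConcLt_drop_amenable hD cayleyGraph heisSkeletonConc cayleyGraph_connected isQuasiTransitive_heisenberg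
    isGraphAmenable_heisenberg (0, 0, 0) (Finset.mem_singleton_self _) criticalProb_heisenberg_lt_one ?_
  rw [heisSkeletonConc_toPlanarSkeleton]
  refine heisSkeleton_cylSubcritical _ ?_
  change criticalProb cayleyGraph ((0, 0, 0) : ℤ × ℤ × ℤ) < 1
  exact criticalProb_heisenberg_lt_one

/-- The same from the binder-less node `SamePDropOfSkeletonConc` (which implies the node of record). [folklore] -/
theorem heisenbergCriticalContinuity_of_skeletonConcNode_of_conc (hD : SamePDropOfSkeletonConc) : HeisenbergCriticalContinuity :=
  heisenbergCriticalContinuity_of_skeletonConcNode (samePDropOfSkeletonConcLt_of_conc hD)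

end Summit.CriticalPhenomena.PercolationContinuityZ3.Theorems.Transplant

end
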